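import Summits.NavierStokesRegularity.NavierStokesRegularity.Theorems.SqueezeCycleExtremalElementExistsRegularity
import HarnessLib

/-!
# Uniform regularity of continuous Type-I Oseen-mild fields on a final time window
# (route `SqueezeCycle`, item `SingularZoom`, stmt-NavierStokesRegularity-10573)

Helper file for the singular Type-I zoom (`SingularZoom`): the window-local twin of
`SqueezeCycleExtremalElementExistsRegularity`. There the fields live on the whole past
`(-∞, 0) × ℝ³`; the zooms `u_k(s, y) = λ_k u(T + λ_k² s, x₀ + λ_k y)` of a Type-I classical
solution live only on `(A_k, 0) × ℝ³` with `A_k → -∞`. A field `u : ℝ → ℝ³ → ℝ³` which is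
jointly continuous on `(A, 0) × ℝ³`, has weakly divergence-free slices there, satisfies the Oseen
integral equation `u t x = e^{(t-s)Δ}u(s)(x) - B¹_s(u,u)(t)(x)` for all `A < s < t < 0`, and obeys
the Type-I bound `‖u(t,x)‖ ≤ C/√(-t)` for `A < t < 0`, is — after a time shift and a clamp — a
restarted bounded mild field of KNSS 2009, §4 on every window `(a, b)`, `A < a < b < 0`
(`isKNSSDriftMild_window_of_Ioo`). Consequently (KNSS 2009, Prop. 4.1 in the tree's rendering
`KNSS2009_prop41_mild_holds`, `KNSSBootstrap.exists_norm_iteratedFDeriv_slice_le`,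
`KNSSBootstrap.exists_lipschitz_time_iteratedFDeriv`) it is jointly `C^∞` on `(A, 0) × ℝ³`
(`contDiffOn_of_Ioo`), and for every order `k`, window `a < b < 0` and margin `δ > 0` there are
constants depending on `k, a, b, δ, C` only which bound `‖Dᵏu(t)(x)‖` on `[a + δ, b) × ℝ³` and
the time-Lipschitz modulus of `Dᵏu(·)(x)` there, uniformly over all such fields with `A < a`
(`exists_norm_iteratedFDeriv_le_of_typeI_Ioo`, `exists_lipschitz_time_of_typeI_Ioo`).
-/

noncomputable section

open MeasureTheory Set Function Filter TopologicalSpace Metric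
open scoped Topology NNReal ENNReal

namespace Summit.NavierStokesRegularity.NavierStokesRegularity.Theorems

open Literature.Analysis Literature.Analysis.FluidPDE

section Window

variable {C A : ℝ} {u : ℝ → EuclideanSpace ℝ (Fin 3) → EuclideanSpace ℝ (Fin 3)}

/-- The Type-I constant of a field obeying `‖u(t,x)‖ ≤ C/√(-t)` at some time `t < 0` is
nonnegative. [folklore] -/
theorem typeI_const_nonneg_of_norm_le {t : ℝ} (ht : t < 0) (x : EuclideanSpace ℝ (Fin 3))
    (h : ‖u t x‖ ≤ C / Real.sqrt (-t)) : 0 ≤ C := by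
  have hs : 0 < Real.sqrt (-t) := Real.sqrt_pos.2 (neg_pos.2 ht)
  by_contra hC
  have : C / Real.sqrt (-t) < 0 := div_neg_of_neg_of_pos (not_le.1 hC) hs
  linarith [norm_nonneg (u t x)]

/-- **A continuous Type-I Oseen-mild field on `(A, 0)` is a restarted bounded mild field on
every window `(a, b)`, `A < a < b < 0`** (KNSS 2009, §4 (i)): the clamped shift
`V τ x = u (max a (min (τ + a) b)) x` satisfies `IsKNSSDriftMild (b - a) (C/√(-b)) V 0`
(the window-local twin of `isKNSSDriftMild_window`: only the values of `u` at times of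
`[a, b] ⊆ (A, 0)` enter). [cite: KochNadirashviliSereginSverak2009, §4 (i) (arXiv:0709.3599v1 p. 8)] -/
theorem isKNSSDriftMild_window_of_Ioo (hc : ContinuousOn (uncurry u) (Ioo A 0 ×ˢ univ))
    (hdiv : ∀ t ∈ Ioo A 0, IsWeaklyDivFree (u t))
    (hmild : ∀ s t : ℝ, A < s → s < t → t < 0 → ∀ x,
      u t x = UnboundedOperators.heatExtension (u s) (t - s) x - oseenDuhamel 1 s u u t x)
    (hI : ∀ t ∈ Ioo A 0, ∀ x, ‖u t x‖ ≤ C / Real.sqrt (-t)) {a b : ℝ} (hAa : A < a)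
    (hab : a < b) (hb : b < 0) :
    IsKNSSDriftMild (b - a) (C / Real.sqrt (-b)) (fun τ x => u (max a (min (τ + a) b)) x) 0 := by
  obtain ⟨hκc, hκmem, hκid⟩ := clampShift_facts hab.le
  have hbI : b ∈ Ioo A 0 := ⟨hAa.trans hab, hb⟩
  have hC : 0 ≤ C := typeI_const_nonneg_of_norm_le hb 0 (hI b hbI 0)
  have hN0 : 0 ≤ C / Real.sqrt (-b) := by positivity
  have hκneg : ∀ τ, max a (min (τ + a) b) < 0 := fun τ => (hκmem τ).2.trans_lt hb
  have hκA : ∀ τ, A < max a (min (τ + a) b) := fun τ => hAa.trans_le (hκmem τ).1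
  have hκI : ∀ τ, max a (min (τ + a) b) ∈ Ioo A 0 := fun τ => ⟨hκA τ, hκneg τ⟩
  have hcont : Continuous (uncurry fun τ x => u (max a (min (τ + a) b)) x) := by
    have hmap : Continuous fun p : ℝ × EuclideanSpace ℝ (Fin 3) =>
        (max a (min (p.1 + a) b), p.2) :=
      (hκc.comp continuous_fst).prodMk continuous_snd
    have hinto : ∀ p : ℝ × EuclideanSpace ℝ (Fin 3),
        (max a (min (p.1 + a) b), p.2) ∈ Ioo A (0 : ℝ) ×ˢ (univ : Set (EuclideanSpace ℝ (Fin 3))) :=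
      fun p => ⟨hκI p.1, mem_univ _⟩
    exact (hc.comp_continuous hmap hinto).congr fun p => rfl
  have hslice : ∀ t ∈ Ioo A 0, Continuous (u t) := fun t ht =>
    hc.comp_continuous (Continuous.prodMk_right t) fun x => ⟨ht, mem_univ x⟩
  have hbd : ∀ τ ∈ Ioo 0 (b - a), ∀ x, ‖u (max a (min (τ + a) b)) x‖ ≤ C / Real.sqrt (-b) := by
    intro τ hτ x
    rw [hκid τ ⟨hτ.1.le, hτ.2.le⟩]
    have hτa : τ + a < 0 := by linarith [hτ.2]
    have hτA : A < τ + a := by linarith [hτ.1]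
    exact (hI (τ + a) ⟨hτA, hτa⟩ x).trans (div_sqrt_neg_le hC (neg_pos.2 hb) (by linarith [hτ.2]))
  refine IsKNSSDriftMild.mk measurable_const (fun t => by simpa using hN0) hcont.measurable hbd
    ?_ ?_
  · exact Eventually.of_forall fun τ => hdiv _ (hκI τ)
  · intro s t hs hst htT x
    have hsid : max a (min (s + a) b) = s + a := hκid s ⟨hs.le, (hst.trans htT).le⟩
    have htid : max a (min (t + a) b) = t + a := hκid t ⟨(hs.trans hst).le, htT.le⟩
    have hVm : ∀ σ ∈ Ioo s t, Measurable fun x => u (max a (min (σ + a) b)) x := fun σ _ =>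
      (hslice _ (hκI σ)).measurable
    have hVN : ∀ σ ∈ Ioo s t, ∀ y, ‖u (max a (min (σ + a) b)) y‖ ≤ C / Real.sqrt (-b) :=
      fun σ hσ y => hbd σ ⟨hs.trans hσ.1, hσ.2.trans htT⟩ y
    rw [driftDuhamel_zero_eq_oseenDuhamel finrank_euclideanSpace_fin hVm hVN hst.le x]
    have hcongr : ∀ τ ∈ Ioo s t, (fun x => u (max a (min (τ + a) b)) x) = (fun σ => u (σ + a)) τ :=
      fun τ hτ => by
        funext y
        rw [hκid τ ⟨(hs.trans hτ.1).le, (hτ.2.trans htT).le⟩]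
    rw [oseenDuhamel_congr_Ioo hcongr hcongr x, oseenDuhamel_translate]
    simp only [hsid, htid]
    have h := hmild (s + a) (t + a) (by linarith) (by linarith) (by linarith) x
    rwa [show t + a - (s + a) = t - s by ring] at h

/-- **Joint smoothness on a window** `(a, b)`, `A < a < b < 0`, of a continuous Type-I
Oseen-mild field on `(A, 0)` (KNSS 2009, Prop. 4.1 via `KNSS2009_prop41_mild_holds`, transported
back along the shift `t ↦ t - a`). [cite: KochNadirashviliSereginSverak2009, Prop. 4.1 (arXiv:0709.3599v1 p. 8)] -/
theorem isSmoothSpaceTimeOn_window_of_Ioo (hc : ContinuousOn (uncurry u) (Ioo A 0 ×ˢ univ))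
    (hdiv : ∀ t ∈ Ioo A 0, IsWeaklyDivFree (u t))
    (hmild : ∀ s t : ℝ, A < s → s < t → t < 0 → ∀ x,
      u t x = UnboundedOperators.heatExtension (u s) (t - s) x - oseenDuhamel 1 s u u t x)
    (hI : ∀ t ∈ Ioo A 0, ∀ x, ‖u t x‖ ≤ C / Real.sqrt (-t)) {a b : ℝ} (hAa : A < a)
    (hab : a < b) (hb : b < 0) :
    IsSmoothSpaceTimeOn (Ioo a b) u := by
  obtain ⟨-, -, hκid⟩ := clampShift_facts hab.le
  have hK := isKNSSDriftMild_window_of_Ioo hc hdiv hmild hI hAa hab hb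
  obtain ⟨ε, -, Cst, -, hP⟩ := KNSS2009_prop41_mild_holds 0
  obtain ⟨hsm, -⟩ := hP hK
  have hmap : ContDiff ℝ ((⊤ : ℕ∞) : WithTop ℕ∞)
      fun p : ℝ × EuclideanSpace ℝ (Fin 3) => (p.1 - a, p.2) :=
    (contDiff_fst.sub contDiff_const).prodMk contDiff_snd
  have hinto : MapsTo (fun p : ℝ × EuclideanSpace ℝ (Fin 3) => (p.1 - a, p.2)) (Ioo a b ×ˢ univ)
      (Ioo 0 (b - a) ×ˢ univ) := by
    rintro ⟨t, x⟩ ⟨ht, -⟩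
    exact ⟨⟨by linarith [ht.1], by linarith [ht.2]⟩, mem_univ _⟩
  have hcomp := hsm.comp hmap.contDiffOn hinto
  refine hcomp.congr ?_
  rintro ⟨t, x⟩ ⟨ht, -⟩
  simp only [comp_apply, uncurry_apply_pair]
  rw [hκid (t - a) ⟨by linarith [ht.1], by linarith [ht.2]⟩, sub_add_cancel]

/-- **Joint smoothness on the whole domain** `(A, 0) × ℝ³` of a continuous Type-I Oseen-mild
field on `(A, 0)` (smoothness is local; every `A < t < 0` lies in a window `(a, t/2)` with
`A < a < t`). [cite: KochNadirashviliSereginSverak2009, Prop. 4.1 (arXiv:0709.3599v1 p. 8)] -/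
theorem contDiffOn_of_Ioo (hc : ContinuousOn (uncurry u) (Ioo A 0 ×ˢ univ))
    (hdiv : ∀ t ∈ Ioo A 0, IsWeaklyDivFree (u t))
    (hmild : ∀ s t : ℝ, A < s → s < t → t < 0 → ∀ x,
      u t x = UnboundedOperators.heatExtension (u s) (t - s) x - oseenDuhamel 1 s u u t x)
    (hI : ∀ t ∈ Ioo A 0, ∀ x, ‖u t x‖ ≤ C / Real.sqrt (-t)) :
    ContDiffOn ℝ (⊤ : ℕ∞) (uncurry u) (Ioo A 0 ×ˢ univ) := by
  refine contDiffOn_of_locally_contDiffOn ?_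
  rintro ⟨t, x⟩ ⟨ht, -⟩
  have htA : A < t := ht.1
  have ht0 : t < 0 := ht.2
  refine ⟨Ioo ((A + t) / 2) (t / 2) ×ˢ univ, isOpen_Ioo.prod isOpen_univ,
    ⟨⟨by linarith, by linarith⟩, mem_univ _⟩, ?_⟩
  have h := isSmoothSpaceTimeOn_window_of_Ioo hc hdiv hmild hI (a := (A + t) / 2) (b := t / 2)
    (by linarith) (by linarith) (by linarith)
  exact ContDiffOn.mono h inter_subset_right

/-! ### Uniform bounds over all fields with the same Type-I constant -/

/-- **Uniform bounds for all `x`-derivatives on a window** (KNSS 2009, (4.10) via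
`KNSSBootstrap.exists_norm_iteratedFDeriv_slice_le`): for `k`, a window `a < b < 0` and a margin
`δ > 0` there is `K = K(k, a, b, δ, C)` with `‖Dᵏu(t)(x)‖ ≤ K` for all `t ∈ [a + δ, b)`, all `x`,
and **all** continuous Type-I Oseen-mild fields `u` on `(A, 0)`, `A < a`, with Type-I constant
`C`. [cite: KochNadirashviliSereginSverak2009, §4 (4.10) with Prop. 4.1 (4.6) (arXiv:0709.3599v1 p. 8)] -/
theorem exists_norm_iteratedFDeriv_le_of_typeI_Ioo (C : ℝ) (k : ℕ) {a b δ : ℝ} (hab : a < b)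
    (hb : b < 0) (hδ : 0 < δ) :
    ∃ K : ℝ, ∀ ⦃A : ℝ⦄ ⦃u : ℝ → EuclideanSpace ℝ (Fin 3) → EuclideanSpace ℝ (Fin 3)⦄, A < a →
      ContinuousOn (uncurry u) (Ioo A 0 ×ˢ univ) →
      (∀ t ∈ Ioo A 0, IsWeaklyDivFree (u t)) →
      (∀ s t : ℝ, A < s → s < t → t < 0 → ∀ x,
        u t x = UnboundedOperators.heatExtension (u s) (t - s) x - oseenDuhamel 1 s u u t x) →
      (∀ t ∈ Ioo A 0, ∀ x, ‖u t x‖ ≤ C / Real.sqrt (-t)) →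
      ∀ t ∈ Ico (a + δ) b, ∀ x, ‖iteratedFDeriv ℝ k (u t) x‖ ≤ K := by
  obtain ⟨Cf, hCf⟩ := KNSSBootstrap.exists_norm_iteratedFDeriv_slice_le
    (E := EuclideanSpace ℝ (Fin 3))
    finrank_euclideanSpace_fin (T := b - a) (N := C / Real.sqrt (-b)) k
  refine ⟨Cf δ, fun A u hAa hc hdiv hmild hI t ht x => ?_⟩
  obtain ⟨-, -, hκid⟩ := clampShift_facts hab.le
  have hK := isKNSSDriftMild_window_of_Ioo hc hdiv hmild hI hAa hab hb
  have h : ‖iteratedFDeriv ℝ k (fun y => u (max a (min (t - a + a) b)) y) x‖ ≤ Cf δ :=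
    hCf hK δ hδ (t - a) ⟨by linarith [ht.1], by linarith [ht.2]⟩ x
  have hV : (fun y => u (max a (min (t - a + a) b)) y) = u t := by
    funext y; rw [hκid (t - a) ⟨by linarith [ht.1], by linarith [ht.2]⟩, sub_add_cancel]
  rwa [hV] at h

/-- **Uniform time-Lipschitz bounds for all `x`-derivatives on a window** (KNSS 2009, (4.11)
via `KNSSBootstrap.exists_lipschitz_time_iteratedFDeriv`): for `k`, `a < b < 0`, `δ > 0` there
is `L = L(k, a, b, δ, C) ≥ 0` with `‖Dᵏu(t)(x) − Dᵏu(s)(x)‖ ≤ L |t − s|` for all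
`s, t ∈ [a + δ, b)`, all `x`, and all continuous Type-I Oseen-mild fields `u` on `(A, 0)`,
`A < a`, with Type-I constant `C`. [cite: KochNadirashviliSereginSverak2009, §4 (4.11) (arXiv:0709.3599v1 p. 8)] -/
theorem exists_lipschitz_time_of_typeI_Ioo (C : ℝ) (k : ℕ) {a b δ : ℝ} (hab : a < b) (hb : b < 0)
    (hδ : 0 < δ) :
    ∃ L : ℝ, 0 ≤ L ∧ ∀ ⦃A : ℝ⦄ ⦃u : ℝ → EuclideanSpace ℝ (Fin 3) → EuclideanSpace ℝ (Fin 3)⦄, A < a →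
      ContinuousOn (uncurry u) (Ioo A 0 ×ˢ univ) →
      (∀ t ∈ Ioo A 0, IsWeaklyDivFree (u t)) →
      (∀ s t : ℝ, A < s → s < t → t < 0 → ∀ x,
        u t x = UnboundedOperators.heatExtension (u s) (t - s) x - oseenDuhamel 1 s u u t x) →
      (∀ t ∈ Ioo A 0, ∀ x, ‖u t x‖ ≤ C / Real.sqrt (-t)) →
      ∀ s ∈ Ico (a + δ) b, ∀ t ∈ Ico (a + δ) b, ∀ x,
        ‖iteratedFDeriv ℝ k (u t) x - iteratedFDeriv ℝ k (u s) x‖ ≤ L * |t - s| := by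
  obtain ⟨L, hL0, hL⟩ := KNSSBootstrap.exists_lipschitz_time_iteratedFDeriv
    (E := EuclideanSpace ℝ (Fin 3))
    finrank_euclideanSpace_fin (T := b - a) (N := C / Real.sqrt (-b)) k hδ
  refine ⟨L, hL0, fun A u hAa hc hdiv hmild hI s hs t ht x => ?_⟩
  obtain ⟨-, -, hκid⟩ := clampShift_facts hab.le
  have hK := isKNSSDriftMild_window_of_Ioo hc hdiv hmild hI hAa hab hb
  have h : ‖iteratedFDeriv ℝ k (fun y => u (max a (min (t - a + a) b)) y) x -
      iteratedFDeriv ℝ k (fun y => u (max a (min (s - a + a) b)) y) x‖ ≤ L * |t - a - (s - a)| :=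
    hL hK (s - a) ⟨by linarith [hs.1], by linarith [hs.2]⟩ (t - a)
      ⟨by linarith [ht.1], by linarith [ht.2]⟩ x
  have hVt : (fun y => u (max a (min (t - a + a) b)) y) = u t := by
    funext y; rw [hκid (t - a) ⟨by linarith [ht.1], by linarith [ht.2]⟩, sub_add_cancel]
  have hVs : (fun y => u (max a (min (s - a + a) b)) y) = u s := by
    funext y; rw [hκid (s - a) ⟨by linarith [hs.1], by linarith [hs.2]⟩, sub_add_cancel]
  rwa [hVt, hVs, show t - a - (s - a) = t - s by ring] at h

end Window

end Summit.NavierStokesRegularity.NavierStokesRegularity.Theorems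

end
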